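import Literature.Analysis.ODE.LiouvilleGreenVolterraBound
import Literature.Analysis.ODE.LiouvilleGreenApproximant
import HarnessLib

/-!
# Olver's Liouville–Green approximation theorem with error bounds: the oscillatory case `f < 0`

Topic `Literature/Analysis/ODE` (namespace `Literature.Analysis.ODE`). Everything is proved; no
definitions.

F. W. J. Olver, *Asymptotics and Special Functions* (1974), Ch. 6 Thm 2.2 (large parameter `u`:
Ch. 10): on a compact interval `[α, β]` let `u > 0`, `f ∈ C²` NEGATIVE, `g ∈ C⁰`, and let
`Φ := 5f′²/(16(−f)^{5/2}) + f″/(4(−f)^{3/2}) − g/(−f)^{1/2}` be the derivative of the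
error-control function of `−f`. Then `w″ = (u² f + g) w` has the complex solution

  `w = (−f)^{-1/4} e^{iuξ}(1 + ε)`,  `ξ = ∫_α^x √(−f)`,  `ε(α) = 0`,
  `‖ε(x)‖ ≤ exp(u⁻¹ ∫_α^x |Φ|) − 1`,  `‖ε′(x)‖ ≤ u √(−f(x)) (exp(u⁻¹ ∫_α^x |Φ|) − 1)`

— exactly Olver's constants (2.22) (no factor `½`: the kernel `sin` of (2.23) does not have a
sign). For real `g` the complex conjugate `w̄` is the second solution `(−f)^{-1/4}e^{−iuξ}(1 + ε̄)`.

* `exists_lgSolution_oscillatory` — for an arbitrary primitive `ξ` of `√(−f)` within `[α, β]`,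
  one-sided data;
* `exists_lgSolution_of_neg` — the packaged statement with `ξ = ∫_α^x √(−f)`, `C¹` on `[α, β]`,
  classical derivatives inside, derivative constant weakened to `2u√(−f)`.

Proof: the a priori bound `norm_lgError_le` over `ℂ` (`LiouvilleGreenVolterraBound.lean`) for
the solution with the Cauchy data of `E₊ = (−f)^{-1/4}e^{iuξ}` at `α`, against the pair
`E_± = (−f)^{-1/4}e^{±iuξ}`: `E″ = (u²f + g + √(−f)Φ)E`, `W(E₋, E₊) = 2iu`, `‖E_±‖ = (−f)^{-1/4}`
(`LiouvilleGreenApproximant.lean`), `m = |Φ|`.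

## References

* F. W. J. Olver, *Asymptotics and Special Functions*, Academic Press 1974, Ch. 6 Thm 2.2
  (eqs. (2.20)–(2.23)), Ch. 10 Thm 3.1. Key `Olver1974`.
-/

noncomputable section

namespace Literature.Analysis.ODE

open Set Filter intervalIntegral _root_.Complex
open _root_.MeasureTheory
open scoped _root_.Topology

variable {u α β : ℝ} {f f' f'' g ξ : ℝ → ℝ}

/-- **Olver's LG theorem, oscillatory case, solution normalised at the left end-point.**
Let `u > 0`, `α ≤ β`, `f ∈ C²[α, β]` (one-sided derivatives within `[α, β]`), `f < 0`,
`g ∈ C[α, β]`, and let `ξ` be any primitive of `√(−f)` within `[α, β]`. Then `w'' = (u² f + g) w`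
has a complex solution `w = (−f)^{-1/4} e^{iuξ} (1 + ε)` on `[α, β]` with `ε(α) = 0`,
`‖ε(x)‖ ≤ exp(u⁻¹ 𝒱_{α,x}(F)) − 1`, `‖ε'(x)‖ ≤ u √(−f(x)) (exp(u⁻¹ 𝒱_{α,x}(F)) − 1)`, where
`𝒱_{α,x}(F) = ∫_α^x |Φ|`, `Φ = 5f'²/(16(−f)^{5/2}) + f''/(4(−f)^{3/2}) − g/(−f)^{1/2}`. This is
Olver's Theorem 2.2 of Ch. 6 (with the large parameter `u`, Ch. 10), proved by the a priori bound
`norm_lgError_le` over `ℂ` against the unimodular pair `(−f)^{-1/4} e^{±iuξ}` (Wronskian `2iu`).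
[cite: Olver1974, Ch. 6 Thm 2.2 & Ch. 10 Thm 3.1] -/
theorem exists_lgSolution_oscillatory (hu : 0 < u) (hαβ : α ≤ β)
    (hf : ∀ t ∈ Icc α β, HasDerivWithinAt f (f' t) (Icc α β) t ∧
      HasDerivWithinAt f' (f'' t) (Icc α β) t)
    (hf'' : ContinuousOn f'' (Icc α β)) (hg : ContinuousOn g (Icc α β))
    (hneg : ∀ t ∈ Icc α β, f t < 0)
    (hξ : ∀ t ∈ Icc α β, HasDerivWithinAt ξ (Real.sqrt (-f t)) (Icc α β) t) :
    ∃ w w' ε ε' : ℝ → ℂ, ε α = 0 ∧ ∀ x ∈ Icc α β,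
      w x = (((-f x) ^ (-(1 / 4 : ℝ)) : ℝ) : ℂ) * Complex.exp (Complex.I * ((u * ξ x : ℝ) : ℂ)) *
        (1 + ε x) ∧
      ‖ε x‖ ≤ Real.exp (u⁻¹ * ∫ t in α..x, |5 * f' t ^ 2 / (16 * (-f t) ^ (5 / 2 : ℝ)) +
        f'' t / (4 * (-f t) ^ (3 / 2 : ℝ)) - g t / Real.sqrt (-f t)|) - 1 ∧
      ‖ε' x‖ ≤ u * Real.sqrt (-f x) * (Real.exp (u⁻¹ * ∫ t in α..x, |5 * f' t ^ 2 /
        (16 * (-f t) ^ (5 / 2 : ℝ)) + f'' t / (4 * (-f t) ^ (3 / 2 : ℝ)) -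
          g t / Real.sqrt (-f t)|) - 1) ∧
      HasDerivWithinAt w (w' x) (Icc α β) x ∧
      HasDerivWithinAt w' (((u ^ 2 * f x + g x : ℝ) : ℂ) * w x) (Icc α β) x ∧
      HasDerivWithinAt ε (ε' x) (Icc α β) x := by
  have hα : α ∈ Icc α β := left_mem_Icc.2 hαβ
  set S := Icc α β with hS
  -- `p = -f > 0` and its derivatives
  set p : ℝ → ℝ := fun t ↦ -f t with hp
  set p' : ℝ → ℝ := fun t ↦ -f' t with hp'
  set p'' : ℝ → ℝ := fun t ↦ -f'' t with hp''
  have hpos : ∀ t ∈ S, 0 < p t := fun t ht ↦ by simpa [hp] using hneg t ht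
  have hpd : ∀ t ∈ S, HasDerivWithinAt p (p' t) S t ∧ HasDerivWithinAt p' (p'' t) S t :=
    fun t ht ↦ ⟨(hf t ht).1.neg, (hf t ht).2.neg⟩
  set σ : ℂ := I * u with hσ
  set E₁ : ℝ → ℂ := fun t ↦ ((p t ^ (-(1 / 4 : ℝ)) : ℝ) : ℂ) * exp (σ * (ξ t : ℂ)) with hE₁
  set dE₁ : ℝ → ℂ := fun t ↦ ((p t ^ (-(1 / 4 : ℝ)) : ℝ) : ℂ) * exp (σ * (ξ t : ℂ)) *
    (((-p' t / (4 * p t) : ℝ) : ℂ) + σ * (Real.sqrt (p t) : ℂ)) with hdE₁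
  set E₂ : ℝ → ℂ := fun t ↦ ((p t ^ (-(1 / 4 : ℝ)) : ℝ) : ℂ) * exp (-σ * (ξ t : ℂ)) with hE₂
  set dE₂ : ℝ → ℂ := fun t ↦ ((p t ^ (-(1 / 4 : ℝ)) : ℝ) : ℂ) * exp (-σ * (ξ t : ℂ)) *
    (((-p' t / (4 * p t) : ℝ) : ℂ) + -σ * (Real.sqrt (p t) : ℂ)) with hdE₂
  set q : ℝ → ℂ := fun t ↦ ((u ^ 2 * f t + g t : ℝ) : ℂ) with hq
  set ρ : ℝ → ℂ := fun t ↦ ((5 * p' t ^ 2 / (16 * p t ^ 2) - p'' t / (4 * p t) - g t : ℝ) : ℂ)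
    with hρ
  set Φ : ℝ → ℝ := fun t ↦ 5 * f' t ^ 2 / (16 * (-f t) ^ (5 / 2 : ℝ)) +
    f'' t / (4 * (-f t) ^ (3 / 2 : ℝ)) - g t / Real.sqrt (-f t) with hΦ
  have hΦp : ∀ t, Φ t = 5 * p' t ^ 2 / (16 * p t ^ (5 / 2 : ℝ)) - p'' t / (4 * p t ^ (3 / 2 : ℝ)) -
      g t / Real.sqrt (p t) := fun t ↦ by
    simp only [hΦ, hp, hp', hp'']
    ring
  -- continuity of the coefficients
  have hfc : ContinuousOn f S := fun t ht ↦ (hf t ht).1.continuousWithinAt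
  have hf'c : ContinuousOn f' S := fun t ht ↦ (hf t ht).2.continuousWithinAt
  have hqc : ContinuousOn q S :=
    continuous_ofReal.comp_continuousOn ((continuousOn_const.mul hfc).add hg)
  have hΦc : ContinuousOn Φ S := by
    have := continuousOn_lgErrorControl (f := p) (f' := p') (f'' := p'') hfc.neg hf'c.neg hf''.neg
      hg hpos
    exact this.congr fun t _ ↦ hΦp t
  -- the solution with the Cauchy data of `E₁` at `α`
  obtain ⟨w, dw, hw0, hw1, hw⟩ := exists_solution_Icc hqc hα (E₁ α) (dE₁ α)
  -- the LG pair solves the comparison equation `E'' = (q + ρ) E`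
  have hqρ : ∀ t, q t + ρ t = σ ^ 2 * (p t : ℂ) +
      ((5 * p' t ^ 2 / (16 * p t ^ 2) - p'' t / (4 * p t) : ℝ) : ℂ) := fun t ↦ by
    simp only [hq, hρ, hσ, hp]
    push_cast
    linear_combination ((u : ℂ) ^ 2 * (f t : ℂ)) * Complex.I_sq
  have hE₁d : ∀ t ∈ S, HasDerivWithinAt E₁ (dE₁ t) S t ∧
      HasDerivWithinAt dE₁ ((q t + ρ t) * E₁ t) S t := fun t ht ↦ by
    obtain ⟨h1, h2⟩ := hasDerivWithinAt_lgCExp σ (hpd t ht).1 (hpd t ht).2 (hξ t ht) (hpos t ht)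
    exact ⟨h1, by rw [hqρ t]; exact h2⟩
  have hE₂d : ∀ t ∈ S, HasDerivWithinAt E₂ (dE₂ t) S t ∧
      HasDerivWithinAt dE₂ ((q t + ρ t) * E₂ t) S t := fun t ht ↦ by
    obtain ⟨h1, h2⟩ :=
      hasDerivWithinAt_lgCExp (-σ) (hpd t ht).1 (hpd t ht).2 (hξ t ht) (hpos t ht)
    exact ⟨h1, by rw [hqρ t, show σ ^ 2 = (-σ) ^ 2 by ring]; exact h2⟩
  have hW : ∀ t ∈ S, E₂ t * dE₁ t - dE₂ t * E₁ t = 2 * σ := fun t ht ↦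
    lgCExp_wronskian σ (hpos t ht)
  have hσ0 : (2 * σ : ℂ) ≠ 0 := by simp [hσ, hu.ne', Complex.I_ne_zero]
  have hσre : σ.re = 0 := by simp [hσ]
  have hσre' : (-σ).re = 0 := by simp [hσ]
  have hnE₁ : ∀ t ∈ S, ‖E₁ t‖ = p t ^ (-(1 / 4 : ℝ)) := fun t ht ↦ norm_lgCExp hσre (hpos t ht)
  have hnE₂ : ∀ t ∈ S, ‖E₂ t‖ = p t ^ (-(1 / 4 : ℝ)) := fun t ht ↦ norm_lgCExp hσre' (hpos t ht)
  have hE₁0 : ∀ t ∈ S, E₁ t ≠ 0 := fun t ht ↦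
    norm_pos_iff.1 (by rw [hnE₁ t ht]; exact Real.rpow_pos_of_pos (hpos t ht) _)
  have hE₂0 : ∀ t ∈ S, E₂ t ≠ 0 := fun t ht ↦
    norm_pos_iff.1 (by rw [hnE₂ t ht]; exact Real.rpow_pos_of_pos (hpos t ht) _)
  -- the pair is unimodular up to the common factor `p^{-1/4}`: the ratio `‖E₁‖/‖E₂‖` is constant
  have hmono : ∀ ⦃t⦄, t ∈ S → ∀ ⦃x⦄, x ∈ S → t ≤ x → ‖E₂ x‖ * ‖E₁ t‖ ≤ ‖E₁ x‖ * ‖E₂ t‖ := by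
    intro t ht x hx _
    rw [hnE₁ t ht, hnE₂ t ht, hnE₁ x hx, hnE₂ x hx]
  -- the majorant `m = |Φ|` and `|ρ| ‖E₁‖ ‖E₂‖ = |Φ|`
  have hm : ContinuousOn (fun t ↦ |Φ t|) S := continuous_abs.comp_continuousOn hΦc
  have hA2 : ∀ t ∈ S, p t ^ (-(1 / 4 : ℝ)) * p t ^ (-(1 / 4 : ℝ)) = (Real.sqrt (p t))⁻¹ :=
    fun t ht ↦ rpow_neg_quarter_mul_self (hpos t ht)
  have hρE : ∀ t ∈ S, ‖ρ t‖ * (‖E₁ t‖ * ‖E₂ t‖) ≤ |Φ t| := by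
    intro t ht
    rw [hnE₁ t ht, hnE₂ t ht, hA2 t ht, hΦp t, lgErrorControl_eq_div_sqrt (hpos t ht), abs_div,
      abs_of_pos (Real.sqrt_pos.2 (hpos t ht))]
    simp only [hρ, Complex.norm_real, Real.norm_eq_abs]
    exact le_of_eq (div_eq_mul_inv _ _).symm
  -- the a priori bound
  have key := norm_lgError_le hw hE₁d hE₂d hW hσ0 hE₁0 hE₂0 hmono hm hρE hw0 hw1
  have hnσ : ‖(2 * σ : ℂ)‖ = 2 * u := by
    simp [hσ, abs_of_pos hu]
  have hc : (2 : ℝ) / ‖(2 * σ : ℂ)‖ = u⁻¹ := by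
    rw [hnσ]
    field_simp
  refine ⟨w, dw, fun x ↦ w x / E₁ x - 1, fun x ↦ (E₁ x * dw x - dE₁ x * w x) / E₁ x ^ 2,
    by simp [hw0, div_self (hE₁0 α hα)], fun x hx ↦ ?_⟩
  obtain ⟨k1, k2⟩ := key x hx
  rw [hc] at k1 k2
  refine ⟨?_, k1, k2.trans_eq ?_, (hw x hx).1, (hw x hx).2, ?_⟩
  · have h1 := hE₁0 x hx
    have : E₁ x = (((-f x) ^ (-(1 / 4 : ℝ)) : ℝ) : ℂ) * exp (I * ((u * ξ x : ℝ) : ℂ)) := by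
      simp only [hE₁, hσ, hp]
      push_cast
      ring_nf
    rw [← this]
    field_simp
    ring
  · rw [hnσ, hnE₁ x hx, hnE₂ x hx, hA2 x hx]
    have hs : Real.sqrt (p x) ≠ 0 := (Real.sqrt_pos.2 (hpos x hx)).ne'
    congr 1
    field_simp
    rfl
  · exact (((hw x hx).1.div (hE₁d x hx).1 (hE₁0 x hx)).sub_const 1).congr_deriv (by ring)

/-- **Olver's Liouville–Green theorem with error bounds, oscillatory case `f < 0`, in the form
consumed by the separated Kerr wave equation** (Olver 1974, Ch. 6 Thm 2.2 with the large
parameter `u` of Ch. 10; derivative constant weakened to `2u√(−f)`). For `u > 0`,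
`f ∈ C²[α, β]` negative, `g ∈ C[α, β]`, the equation `w'' = (u² f + g) w` has the complex solution
`w = (−f)^{-1/4} e^{iu∫_α^x √(−f)}(1 + ε)`, `C¹` on `[α, β]` and `C²` inside, with `ε(α) = 0`,
`‖ε(x)‖ ≤ exp(u⁻¹∫_α^x |Φ|) − 1`, `‖ε'(x)‖ ≤ 2u√(−f(x))·(same)`,
`Φ = 5f'²/(16(−f)^{5/2}) + f''/(4(−f)^{3/2}) − g/(−f)^{1/2}` (its complex conjugate is a second,
independent solution). [cite: Olver1974, Ch. 6 Thm 2.2 & Ch. 10 Thm 3.1] -/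
theorem exists_lgSolution_of_neg (u α β : ℝ) (f f' f'' g : ℝ → ℝ) (hu : 0 < u) (hαβ : α ≤ β)
    (hf : ∀ t ∈ Icc α β, HasDerivAt f (f' t) t ∧ HasDerivAt f' (f'' t) t)
    (hf'' : ContinuousOn f'' (Icc α β)) (hg : ContinuousOn g (Icc α β))
    (hneg : ∀ t ∈ Icc α β, f t < 0) :
    ∃ (w w' ε ε' : ℝ → ℂ),
      (∀ x ∈ Icc α β,
          w x = (((-f x) ^ (-(1 / 4 : ℝ)) : ℝ) : ℂ) *
              Complex.exp (Complex.I * ((u * ∫ t in α..x, Real.sqrt (-f t) : ℝ) : ℂ)) * (1 + ε x) ∧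
          ‖ε x‖ ≤ Real.exp (u⁻¹ * ∫ t in α..x, |5 * f' t ^ 2 / (16 * (-f t) ^ (5 / 2 : ℝ)) +
            f'' t / (4 * (-f t) ^ (3 / 2 : ℝ)) - g t / Real.sqrt (-f t)|) - 1 ∧
          ‖ε' x‖ ≤ 2 * u * Real.sqrt (-f x) * (Real.exp (u⁻¹ * ∫ t in α..x, |5 * f' t ^ 2 /
            (16 * (-f t) ^ (5 / 2 : ℝ)) + f'' t / (4 * (-f t) ^ (3 / 2 : ℝ)) -
              g t / Real.sqrt (-f t)|) - 1)) ∧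
      ε α = 0 ∧ ContinuousOn w (Icc α β) ∧ ContinuousOn w' (Icc α β) ∧
      (∀ x ∈ Ioo α β,
          HasDerivAt ε (ε' x) x ∧ HasDerivAt w (w' x) x ∧
          HasDerivAt w' (((u ^ 2 * f x + g x : ℝ) : ℂ) * w x) x) := by
  have hfw : ∀ t ∈ Icc α β, HasDerivWithinAt f (f' t) (Icc α β) t ∧
      HasDerivWithinAt f' (f'' t) (Icc α β) t := fun t ht ↦
    ⟨(hf t ht).1.hasDerivWithinAt, (hf t ht).2.hasDerivWithinAt⟩
  have hfc : ContinuousOn f (Icc α β) := fun t ht ↦ (hf t ht).1.continuousAt.continuousWithinAt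
  have hξd : ∀ t ∈ Icc α β, HasDerivWithinAt (fun x ↦ ∫ s in α..x, Real.sqrt (-f s))
      (Real.sqrt (-f t)) (Icc α β) t := fun t ht ↦ hasDerivWithinAt_integral_Icc hfc.neg.sqrt ht
  obtain ⟨w, w', ε, ε', hεα, h⟩ := exists_lgSolution_oscillatory hu hαβ hfw hf'' hg hneg hξd
  have hR : ∀ x ∈ Icc α β, 0 ≤ Real.exp (u⁻¹ * ∫ t in α..x,
      |5 * f' t ^ 2 / (16 * (-f t) ^ (5 / 2 : ℝ)) + f'' t / (4 * (-f t) ^ (3 / 2 : ℝ)) -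
        g t / Real.sqrt (-f t)|) - 1 := by
    intro x hx
    have : 0 ≤ ∫ t in α..x, |5 * f' t ^ 2 / (16 * (-f t) ^ (5 / 2 : ℝ)) +
        f'' t / (4 * (-f t) ^ (3 / 2 : ℝ)) - g t / Real.sqrt (-f t)| :=
      intervalIntegral.integral_nonneg hx.1 fun t _ ↦ abs_nonneg _
    have : (1 : ℝ) ≤ Real.exp (u⁻¹ * ∫ t in α..x, |5 * f' t ^ 2 / (16 * (-f t) ^ (5 / 2 : ℝ)) +
        f'' t / (4 * (-f t) ^ (3 / 2 : ℝ)) - g t / Real.sqrt (-f t)|) :=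
      Real.one_le_exp_iff.2 (by positivity)
    linarith
  refine ⟨w, w', ε, ε', fun x hx ↦ ?_, hεα, fun x hx ↦ (h x hx).2.2.2.1.continuousWithinAt,
    fun x hx ↦ (h x hx).2.2.2.2.1.continuousWithinAt, fun x hx ↦ ?_⟩
  · obtain ⟨e1, b1, d1, -, -, -⟩ := h x hx
    have hs : 0 ≤ u * Real.sqrt (-f x) := by positivity
    refine ⟨e1, b1, d1.trans ?_⟩
    have h0 := hR x hx
    nlinarith
  · have hS : Icc α β ∈ 𝓝 x := Icc_mem_nhds hx.1 hx.2
    obtain ⟨-, -, -, d1, d2, d3⟩ := h x (Ioo_subset_Icc_self hx)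
    exact ⟨d3.hasDerivAt hS, d1.hasDerivAt hS, d2.hasDerivAt hS⟩

end Literature.Analysis.ODE
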